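import Summits.Ventures.LatticeQCDFlow.Scaling.SectorExactSlowSwapLaw
import Summits.Ventures.LatticeQCDFlow.Scaling.DominatedStarRegimeFreeTimeAverages

/-!
HONEST FRAMING: exact (Metropolis-corrected) sampling algorithms for lattice gauge theory; figures
of merit are autocorrelation/cost numbers at stated couplings and volumes; no continuum-physics
claim.

# SectorExactSlowSwapSampleSize — THE HONEST SAMPLE SIZE WITH PARTITION-EXACT FLOWS AND ANY NUMBER OF SECTORS AT SLOW SWAPS, FROM EVERY START, WITHOUT THE LABEL
# ENTROPY: BURN-IN `r ≥ max{2⌈ρ₁⁻¹·log(8C₁/ε)⌉, ⌈(4/(hρ))·log(8C₂/ε)⌉}`, RUN `N ≥ (4Var_π̃(f)/(η²ε))/(p·min{ct/(3m), h/(7K)})` ⇒ `P_x{|N⁻¹Σ_{s<N} f(X_{r+s}) − E_π̃ f| ≥ η} ≤ ε`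
# (lean-2 GEN-34, ours)

Venture-side (OURS).  Cell `lqcd-flow` (pub-lqcd), unit `pub-lqcd-lean-2-g34`, 2026-08-29.  Chapter U, file 7 = Q8 (`SectorExactSampleSize`) for ANY number of sectors with the
slow-swap burn-in of U4 (`SectorExactSlowSwapLaw`): `C₁ = 1 + K(2t+h)/(2t)`, `ρ₁ = (th/(2t+h))·min{hpc/m, 1/(K+1)}` (the stale mass), `C₂ = eK/(p·W_lo) + 1`, `ρ = (t/(t+h))(p/3)/K` (the
label star's slow-swap law), chapter N's regime-free gap `p·min{ct/(3m), h/(7K)}` (`dominatedStar_spectralGap_ge_regimeFree`, one-sided domination from `p·c_r(b) ≤ 1`), and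
Levin–Peres–Wilmer's Theorem 12.21 (in the tree).

* **`sectorExact_slowSwap_timeAverage`** — finite `S` partitioned by `ℓ : S → L` (`L` non-empty), hot law `μ_0` and `K ≥ 1` cold levels of ONE law `μ_1` (positive), sector-preserving
  entry bijections exact on each sector up to its weight (`μ_1(φ_r u) = c_r(ℓu)μ_0(u)`, `p·c_r(b) ≤ 1`, `p > 0`), uniform entry list (`c ≥ 1` per level), exact hot redraws (`w_0 > 0`),
  `μ_1`-REVERSIBLE sector-confined row-stochastic cold kernels, `0 < t < 1`, `4t ≤ h`, `W_lo ≤ max{W(b),W(b')}` for labels `b ≠ b'` (`W = μ^L_1/μ^L_0`): from EVERY start, with the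
  burn-in and run length of the title, the time average of any `f` deviates from `E_π̃ f` by `≥ η` with probability `≤ ε`.

Reading (no numerics implied): the topological-freezing recipe with any number of sectors at slow swaps — burn-in `O((K + m/(hpc))(1/t)log(K/ε) + (K/(pt))log(K/(pW_lo ε)))`, averaging
`O(Var·max{m/(ct), K/h}/(pη²ε))` — polynomial in `K`, linear in `1/p`, free of `|S|`, `π̃_min`, any regime and the label entropy.  NOT CLAIMED: fast swaps; flows inexact within a
sector; anything measured.  Literature grade (cell rule): OWN COMPOSITION on U4, N2 and the typed [LevinPeres2017, Thm 12.21]; nothing new cited as a fact; no new bib keys.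
-/

noncomputable section

open Finset Function Matrix
open Literature.Probability.MarkovChains

namespace Summit.Ventures.LatticeQCDFlow.Scaling

variable {S : Type*} [Fintype S] [DecidableEq S] {K m : ℕ} {μ : Fin (K + 1) → S → ℝ} {M : Fin (K + 1) → S → S → ℝ}
  {w : Fin (K + 1) → ℝ} {t : ℝ}

section SampleSize
variable (κ : Fin m → Fin K) (φ : Fin m → Equiv.Perm S) {L : Type*} [Fintype L] [DecidableEq L] (ℓ : S → L)

set_option maxHeartbeats 400000 in
/-- **THE HONEST SAMPLE SIZE WITH PARTITION-EXACT FLOWS, ANY NUMBER OF SECTORS, SLOW SWAPS, FROM EVERY START.** [ours] -/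
theorem sectorExact_slowSwap_timeAverage [Nontrivial S] [Nonempty L] (hK : 1 ≤ K) (hm : 1 ≤ m) (ht0 : 0 < t) (ht1 : t < 1) (hw0 : ∀ k, 0 ≤ w k)
    (hw00 : 0 < w 0) (hw1 : ∑ k, w k = 1) (hμ : ∀ k x, 0 < μ k x) (hμ1 : ∀ k, ∑ u, μ k u = 1) (hhom : ∀ i : Fin K, μ i.succ = μ 1)
    (hφℓ : ∀ r u, ℓ (φ r u) = ℓ u)
    {cL : Fin m → L → ℝ} (hcL : ∀ r b, 0 < cL r b) (hexact : ∀ r u, μ (κ r).succ (φ r u) = cL r (ℓ u) * μ 0 u)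
    (hM : ∀ k, IsRowStochastic (M k)) (hMrev : ∀ k, DetailedBalance (μ k) (M k)) (hM0 : ∀ u v, M 0 u v = μ 0 v)
    (hconf : ∀ k : Fin (K + 1), k ≠ 0 → ∀ u v, ℓ u ≠ ℓ v → M k u v = 0)
    {μB : Fin (K + 1) → L → ℝ} (hμB : ∀ k b, μB k b = ∑ u ∈ univ.filter (fun u => ℓ u = b), μ k u)
    (hμB0 : ∀ k b, 0 < μB k b) {p : ℝ} (hp0 : 0 < p) (hp1 : p ≤ 1) (hpc : ∀ r b, p * cL r b ≤ 1)
    {c : ℕ} (hc1 : 1 ≤ c) (hunif : ∀ i : Fin K, (univ.filter fun r : Fin m => κ r = i).card = c)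
    {Wlo : ℝ} (hWlo0 : 0 < Wlo) (hWlo : ∀ b b', b ≠ b' → Wlo ≤ max (μB 1 b / μB 0 b) (μB 1 b' / μB 0 b'))
    (hslow : 4 * t ≤ (1 - t) * w 0)
    (f : (Fin (K + 1) → S) → ℝ) {ε η : ℝ} (hε : 0 < ε) (hη : 0 < η) {r N : ℕ}
    (hr : max (2 * ⌈1 / (t * ((1 - t) * w 0) / (2 * t + (1 - t) * w 0) * min ((1 - t) * w 0 * p * c / m) (1 / (K + 1)))
              * Real.log (2 * (1 + K * (2 * t + (1 - t) * w 0) / (2 * t)) / (ε / 4))⌉₊)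
          ⌈1 / ((1 - t) * w 0 * (t / (t + (1 - t) * w 0) * (p / 3) / K) / 4)
              * Real.log (2 * (Real.exp 1 * (K * (1 / (p * Wlo))) + 1) / (ε / 4))⌉₊ ≤ r) (hN : 0 < N)
    (hNvar : 4 * lawVariance (tensorFun μ) f / (η ^ 2 * ε) * (1 / (p * min (c * t / (3 * m)) ((1 - t) * w 0 / (7 * K)))) ≤ N)
    (x : Fin (K + 1) → S) :
    pathSum (fun y z : Fin (K + 1) → S =>
        t * ptGraphSwap μ (fun r : Fin m => (((0 : Fin (K + 1)), (κ r).succ) : Fin (K + 1) × Fin (K + 1))) φ y z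
          + (1 - t) * prodKernel w M y z) (N + r) x (fun ω =>
        if η ≤ |(∑ s : Fin N, f ((Matrix.vecCons x ω : Fin (N + r + 1) → (Fin (K + 1) → S))
              ⟨(s : ℕ) + r, by have := s.isLt; omega⟩)) / N - lawMean (tensorFun μ) f|
          then (1 : ℝ) else 0) ≤ ε := by
  have hmpos : (0 : ℝ) < m := Nat.cast_pos.mpr (by omega)
  have hKpos : (0 : ℝ) < K := Nat.cast_pos.mpr (by omega)
  have hh0 : 0 < (1 - t) * w 0 := mul_pos (by linarith) hw00
  have hstat : ∀ k : Fin (K + 1), k ≠ 0 → ∀ v, ∑ u, μ k u * M k u v = μ k v := fun k _ v => (hMrev k).isStationary (hM k).2 v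
  have hdom : ∀ (r : Fin m) (u : S), p * μ (κ r).succ (φ r u) ≤ μ 0 u := fun r u => by
    rw [hexact]
    calc p * (cL r (ℓ u) * μ 0 u) = (p * cL r (ℓ u)) * μ 0 u := by ring
      _ ≤ 1 * μ 0 u := mul_le_mul_of_nonneg_right (hpc r (ℓ u)) (hμ 0 u).le
      _ = μ 0 u := one_mul _
  have hc : ∀ p' : Fin K, c ≤ (univ.filter (fun r : Fin m => κ r = p')).card := fun p' => (hunif p').ge
  have hP := weightedScheme_isRowStochastic (t := t) (w := w)
    (ptGraphSwap_isRowStochastic (e := fun r : Fin m => (((0 : Fin (K + 1)), (κ r).succ) : Fin (K + 1) × Fin (K + 1))) (φ := φ) hμ)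
    hM hw0 hw1 ht0.le ht1.le
  have hDB := weightedScheme_detailedBalance (w := w)
    (ptGraphSwap_detailedBalance (e := fun r : Fin m => (((0 : Fin (K + 1)), (κ r).succ) : Fin (K + 1) × Fin (K + 1))) (φ := φ) hμ) hMrev t
  have hirr := dominatedStar_isIrreducible_regimeFree κ φ ht0 ht1 hw0 hw00 hw1 hμ hM hM0 hc1 hc
  have hε2 : 0 < ε / 2 := by linarith
  have hε4 : 0 < ε / 4 := by linarith
  -- the burn-in of U4 at accuracy `ε/2`: `t_mix(ε/2) ≤ r₀` AND `d(r₀) ≤ ε/2` (the two terms of the law are each `≤ ε/4` at `r₀`)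
  set h := (1 - t) * w 0 with hh
  set θ := 2 * t / (2 * t + h) with hθ
  have hθ0 : 0 < θ := by positivity
  have hθ1 : θ ≤ 1 := by rw [hθ, div_le_one (by positivity)]; linarith
  have h1θ : 1 - θ = h / (2 * t + h) := by rw [hθ]; field_simp; ring
  have hreg : (1 - θ) * t ≤ (1 - t) * w 0 * θ := by
    rw [h1θ, ← hh, hθ]
    rw [div_mul_eq_mul_div, mul_div_assoc', div_le_div_iff_of_pos_right (by positivity)]
    nlinarith [mul_pos ht0 hh0]
  set ρ := t * h / (2 * t + h) * min (h * p * c / m) (1 / (K + 1)) with hρ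
  have hρ0 : 0 < ρ := by
    have : 0 < min (h * p * c / (m : ℝ)) (1 / ((K : ℝ) + 1)) := lt_min (by positivity) (by positivity)
    positivity
  have hρ1 : ρ ≤ 1 := by
    have h1 : t * h / (2 * t + h) ≤ 1 := by rw [div_le_one (by positivity)]; nlinarith [mul_pos ht0 hh0]
    have h2 : min (h * p * c / (m : ℝ)) (1 / ((K : ℝ) + 1)) ≤ 1 := (min_le_right _ _).trans (by
      rw [div_le_one (by positivity)]; linarith [Nat.cast_nonneg (α := ℝ) K])
    have h3 : 0 ≤ min (h * p * c / (m : ℝ)) (1 / ((K : ℝ) + 1)) := le_min (by positivity) (by positivity)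
    calc ρ ≤ 1 * 1 := mul_le_mul h1 h2 h3 zero_le_one
      _ = 1 := one_mul 1
  set a := h * (t / (t + h) * (p / 3) / K) / 4 with ha
  have ha0 : 0 < a := by positivity
  set C₁ := 1 + K * (2 * t + h) / (2 * t) with hC₁
  have hC₁0 : 0 < C₁ := by positivity
  set C₂ := Real.exp 1 * (K * (1 / (p * Wlo))) + 1 with hC₂
  have hC₂0 : 0 < C₂ := by positivity
  set N₁ : ℕ := ⌈1 / ρ * Real.log (2 * C₁ / (ε / 4))⌉₊ with hN₁
  set N₂ : ℕ := ⌈1 / a * Real.log (2 * C₂ / (ε / 4))⌉₊ with hN₂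
  set r₀ : ℕ := max (2 * N₁) N₂ with hr₀
  have hlaw := sectorExact_worstTvDist_le_slowSwap κ φ ℓ hm ht0 ht1 hw0 hw00 hw1 hμ hμ1 hhom hφℓ hcL hexact hM hM0 hstat hconf hμB hμB0
    hp0 hpc hθ0 hθ1 hreg hunif hWlo0 hWlo hslow r₀
  have hrate : ρ ≤ min ((1 - t) * w 0 * (1 - θ) * p * c * t / m) (((1 - t) * w 0 * θ - (1 - θ) * t) / (K + θ)) := by
    refine le_min ?_ ?_
    · calc ρ ≤ t * h / (2 * t + h) * (h * p * c / m) := mul_le_mul_of_nonneg_left (min_le_left _ _) (by positivity)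
        _ = (1 - t) * w 0 * (1 - θ) * p * c * t / m := by rw [h1θ, ← hh]; ring
    · calc ρ ≤ t * h / (2 * t + h) * (1 / (K + 1)) := mul_le_mul_of_nonneg_left (min_le_right _ _) (by positivity)
        _ ≤ t * h / (2 * t + h) * (1 / (K + θ)) := by gcongr
        _ = ((1 - t) * w 0 * θ - (1 - θ) * t) / (K + θ) := by rw [← hh, h1θ, hθ]; field_simp; ring
  have hconst : (θ + K) / θ = C₁ := by rw [hC₁, hθ]; field_simp
  have hbase0 : 0 ≤ 1 - min ((1 - t) * w 0 * (1 - θ) * p * c * t / m) (((1 - t) * w 0 * θ - (1 - θ) * t) / (K + θ)) := by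
    have h2 : min ((1 - t) * w 0 * (1 - θ) * p * c * t / m) (((1 - t) * w 0 * θ - (1 - θ) * t) / (K + θ))
        ≤ ((1 - t) * w 0 * θ - (1 - θ) * t) / (K + θ) := min_le_right _ _
    have h3 : ((1 - t) * w 0 * θ - (1 - θ) * t) / (K + θ) ≤ 1 := by
      rw [div_le_one (by positivity)]
      have hw01 : w 0 ≤ 1 := by
        calc w 0 ≤ ∑ k, w k := Finset.single_le_sum (fun k _ => hw0 k) (mem_univ 0)
          _ = 1 := hw1
      nlinarith [mul_nonneg (sub_nonneg.mpr ht1.le) (hw0 0), mul_nonneg (sub_nonneg.mpr hθ1) ht0.le, hθ0.le,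
        mul_le_mul_of_nonneg_left hw01 (sub_nonneg.mpr ht1.le), Nat.cast_nonneg (α := ℝ) K]
    linarith
  have hn1 : N₁ ≤ r₀ / 2 := by omega
  have hfirst : (θ + K) / θ * (1 - min ((1 - t) * w 0 * (1 - θ) * p * c * t / m)
      (((1 - t) * w 0 * θ - (1 - θ) * t) / (K + θ))) ^ (r₀ / 2) ≤ ε / 4 := by
    have hg := geom_le_of_ge_log hρ0 hρ1 (by positivity : 0 < 2 * C₁) hε4 (n := N₁) (Nat.le_ceil _)
    calc (θ + K) / θ * (1 - min ((1 - t) * w 0 * (1 - θ) * p * c * t / m) (((1 - t) * w 0 * θ - (1 - θ) * t) / (K + θ))) ^ (r₀ / 2)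
        ≤ C₁ * (1 - ρ) ^ (r₀ / 2) := by
          rw [hconst]
          exact mul_le_mul_of_nonneg_left (pow_le_pow_left₀ hbase0 (by linarith [hrate]) _) hC₁0.le
      _ ≤ C₁ * (1 - ρ) ^ N₁ := mul_le_mul_of_nonneg_left (pow_le_pow_of_le_one (by linarith) (by linarith) hn1) hC₁0.le
      _ = (2 * C₁ * (1 - ρ) ^ N₁) / 2 := by ring
      _ ≤ ε / 4 := by linarith only [hg, hε4]
  have hn2 : N₂ ≤ r₀ := le_max_right _ _
  have hsecond : C₂ * Real.exp (-((1 - t) * w 0 * (t / (t + (1 - t) * w 0) * (p / 3) / K) / 4) * r₀) ≤ ε / 4 := by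
    have hg := exp_le_of_ge_log ha0 (by positivity : 0 < 2 * C₂) hε4 (n := N₂) (Nat.le_ceil _)
    rw [← hh, ← ha]
    have hmono : Real.exp (-a * r₀) ≤ Real.exp (-a * N₂) := by
      rw [Real.exp_le_exp]
      have : (N₂ : ℝ) ≤ r₀ := by exact_mod_cast hn2
      have h2 := mul_le_mul_of_nonneg_left this ha0.le
      linarith only [h2]
    calc C₂ * Real.exp (-a * r₀) ≤ C₂ * Real.exp (-a * N₂) := mul_le_mul_of_nonneg_left hmono hC₂0.le
      _ = (2 * C₂ * Real.exp (-a * N₂)) / 2 := by ring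
      _ ≤ ε / 4 := by linarith only [hg, hε4]
  have ht₀ : worstTvDist (fun y z : Fin (K + 1) → S =>
      t * ptGraphSwap μ (fun r : Fin m => (((0 : Fin (K + 1)), (κ r).succ) : Fin (K + 1) × Fin (K + 1))) φ y z
        + (1 - t) * prodKernel w M y z) (tensorFun μ) r₀ ≤ ε / 2 := hlaw.trans (by linarith only [hfirst, hsecond])
  have hmix : mixingTime (fun y z : Fin (K + 1) → S =>
      t * ptGraphSwap μ (fun r : Fin m => (((0 : Fin (K + 1)), (κ r).succ) : Fin (K + 1) × Fin (K + 1))) φ y z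
        + (1 - t) * prodKernel w M y z) (tensorFun μ) (ε / 2) ≤ r₀ := mixingTime_le _ _ ht₀
  -- the run length through `Gap ≥ p·min{ct/(3m), (1−t)w_0/(7K)}`
  have hgap := dominatedStar_spectralGap_ge_regimeFree κ φ hK hm ht0 ht1 hw0 hw00 hw1 hμ hμ1 hM hMrev hM0 hp0 hp1 hdom hc1 hc
  have hGpos : 0 < p * min (c * t / (3 * m)) ((1 - t) * w 0 / (7 * K)) := mul_pos hp0 (lt_min (by positivity) (by rw [← hh]; positivity))
  have hγinv : (spectralGap (tensorFun μ) (fun y z : Fin (K + 1) → S =>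
      t * ptGraphSwap μ (fun r : Fin m => (((0 : Fin (K + 1)), (κ r).succ) : Fin (K + 1) × Fin (K + 1))) φ y z
        + (1 - t) * prodKernel w M y z))⁻¹ ≤ 1 / (p * min (c * t / (3 * m)) ((1 - t) * w 0 / (7 * K))) := by
    rw [← one_div]; exact one_div_le_one_div_of_le hGpos hgap
  have hV : 0 ≤ 4 * lawVariance (tensorFun μ) f / (η ^ 2 * ε) :=
    div_nonneg (mul_nonneg (by norm_num) (lawVariance_nonneg (fun z => (tensorFun_pos hμ z).le) f)) (by positivity)
  exact LevinPeres2017_thm_12_21 (fun z => tensorFun_pos hμ z) (sum_tensorFun_eq_one _ hμ1) hP hDB hirr f hε hη ht₀ (hmix.trans hr) hN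
    ((mul_le_mul_of_nonneg_left hγinv hV).trans hNvar) x

end SampleSize

end Summit.Ventures.LatticeQCDFlow.Scaling

end
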